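import Summits.QuantumFields.BalabanUV.T4Continuum.Support.NE7AllMinimisersSmallSU2
import Summits.QuantumFields.BalabanUV.T4Continuum.Support.NE3EnergyShapes
import HarnessLib

/-!
# NE7MinimalOrbitUniqueSU2 — UNIQUENESS OF THE MINIMAL ORBIT FOR SU(2), d = 4, L = 2, NO DISPLAYED HYPOTHESIS: over every datum of the small data and at every level, the set of constrained
# minimisers of the small-field class `sfClass 4 2 N ε` is ONE periodic unitary gauge orbit — [Balaban1985Variational] Thm 1 «at most one critical orbit» TYPE, together with existence ((8)∃)

Cell `pub-balaban`, rung (B)+1 sub-cell t4, lineage `b2b-balaban-t4-ne7-p1`, generation 105 (CRUX PROVER NE7 #1 = OWNER of BINDER row NE7).  Memo `t4/b2b-balaban-t4-ne7-p1-g105/ROAD-G105.md` §7.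
THE ARGUMENT (as for (8)∀, `NE7AllMinimisersSmallSU2`).  `U♯` := the (8)∃ minimiser of the SMALLER class `sfClass 4 2 N (ε∕4)` at level `k+1` (gen 104's `hint_SU2_small_data` at `ε∕4`):
admissible in the `ε`-class, interior in its own class, hence tangent-critical (`tanCritical_of_isMinimiser`).  For every minimiser `U′` of the `ε`-class, gen 105's pair decomposition
`NE7PairDecompNL0.decomp_of_nl0_pair` gives a periodic unitary `u` and `X = X_T + X_N` over the energy block-Landau slice with `U′^{u} = U♯·e^{X}` and the weighted letters, under the per-level
strict line (gen 104's k-free `line_of_small` carried to the level by `NE7EnergyRateWPrep.kfree_coercivity`); gen 99's «at most one minimal orbit»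
`NE7ConvOneStepGenericSliceTangent.vary_eq_self_of_tanCritical_rep_generic` (with the 𝒯_E instances `hT_energyBlockLandau` ∕ `classSlicePoincare_energyBlockLandau_SU2`) forces `X = 0`,
i.e. `U′^{u} = U♯`.  So every minimiser is a gauge copy of `U♯`, and `U♯` is itself a minimiser of the `ε`-class (its action equals that of the (8)∃ minimiser of the `ε`-class, a gauge copy).
Level `0`: the only admissible configuration is the datum.
WHAT ([folklore]; 0 def, 0 sorry).  **`minimal_orbit_unique_SU2`**: `card n = 2 → ∃ ε₀ > 0, ∀ 0 < ε ≤ ε₀, ∀ N ≥ 1, ∃ δ_V > 0, ∀ V (unitary, N-periodic, SmallField V δ_V), ∀ k, ∃ U♯,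
IsMinimiser 4 (sfClass 4 2 N ε) 2 N k V U♯ ∧ ∀ U′, IsMinimiser 4 (sfClass 4 2 N ε) 2 N k V U′ → ∃ u, IsUnitarySite u ∧ IsPeriodicSite u (N·2^k) ∧ gaugeAct u U′ = U♯`.
HONEST FRAMING (page 1): composition of landed kernel theorems of this lineage (gens 94–105) and [B7]∕[B8]∕[B11] AS TYPED; nothing of Bałaban's asserted as an axiom; SU(2) (`n : Type`), `L = 2`,
finite 4-torus, small data, constants existential; NOT NE7, NOT NE3; spine count = dagwriter∕referees' call; NOT infinite volume, NOT mass gap, NOT BetaPertH, NOT Clay (continuum YM on T⁴ ⇐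
BetaPertH ∧ nine spine estimates).
-/

set_option autoImplicit false

open scoped BigOperators Matrix Matrix.Norms.L2Operator
open NormedSpace Finset Set

namespace Summit.QuantumFields.BalabanUV.T4Continuum.NE7MinimalOrbitUniqueSU2

open Literature.MathematicalPhysics.QuantumFieldTheory.Balaban1983to89
open B7Prop1Explicit B7Prop2Explicit
open T4AveragingDeficitWall (IsUnitaryCfg IsSkewDir SmallField vary curl curlSq dirSq)
open T4AveragingDeficitWallBoundary (IsPeriodicCfg periodBox)
open AveragingDeficitPeriodicCounting (IsPeriodicDir)
open AveragingDeficitMultiLevelPrep (LevelSmall TangentIter)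
open MinimalActionLevels (perWin levelAction)
open MinimalActionSandwich (IsMinimiser admissible)
open MinimalActionRate (sfClass)
open NE3HessForm (dAction)
open NE3SlicePoincareShape (SlicePoincare slicePoincare_mono)
open NE3SlicePoincareBudgetLine (CPLine)
open NE3ClassRadiusFamily (CPLine_nonneg_d4_L2)
open NE3EnergyShapes (IsUnitarySite IsPeriodicSite gaugeAct_one)
open NE3EnergyWeightedShapes (energyNormW)
open NE7MeanZeroGaugeSliceW (energyBlockLandauW)
open NE7EnergyBlockLandauClassPoincare (classSlicePoincare_energyBlockLandau_SU2)
open NE7ConvOneStepGenericSlice (hT_energyBlockLandau)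
open NE7ConvOneStepSU2 (levelSmall_all_d4_L2)
open NE7ConvOneStepGenericSliceTangent (vary_eq_self_of_tanCritical_rep_generic)
open NE7OpenOfMinimisation (tanCritical_of_isMinimiser)
open NE7HintUnconditionalSU2 (line_of_small hint_SU2_small_data)
open NE7PairDecompNL0 (decomp_of_nl0_pair)
open NE7EnergyRateWPrep (kfree_coercivity)
open NE7EtaMinimiserGaugeCovariance (levelAction_gaugeAct)
open BlockAverageCurrent (smallField_gaugeAct)
open NE7AllMinimisersSmallSU2 (admissible_mono_radius eq_of_admissible_zero)

noncomputable section

variable {n : Type} [Fintype n] [DecidableEq n]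

set_option maxHeartbeats 800000 in
/-- **THE MINIMAL SET IS ONE GAUGE ORBIT, SU(2), `d = 4`, `L = 2`** (statement and argument in the file header). [folklore] -/
theorem minimal_orbit_unique_SU2 [Nonempty n] (hn : Fintype.card n = 2) :
    ∃ ε₀ : ℝ, 0 < ε₀ ∧ ∀ ε : ℝ, 0 < ε → ε ≤ ε₀ → ∀ (N : ℕ) [NeZero N], 1 ≤ N →
      ∃ δV : ℝ, 0 < δV ∧
        ∀ V ∈ {V : Site 4 → Fin 4 → (Matrix n n ℂ)ˣ | IsUnitaryCfg V ∧ IsPeriodicCfg V (N : ℤ) ∧ SmallField V δV},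
        ∀ k : ℕ, ∃ Us : Site 4 → Fin 4 → (Matrix n n ℂ)ˣ, IsMinimiser 4 (sfClass 4 2 N ε) 2 N k V Us ∧
          ∀ U' : Site 4 → Fin 4 → (Matrix n n ℂ)ˣ, IsMinimiser 4 (sfClass 4 2 N ε) 2 N k V U' →
            ∃ u : Site 4 → (Matrix n n ℂ)ˣ, IsUnitarySite u ∧ IsPeriodicSite u ((N * 2 ^ k : ℕ) : ℤ) ∧ gaugeAct u U' = Us := by
  obtain ⟨ε₁, hε₁, H⟩ := hint_SU2_small_data (n := n) hn
  obtain ⟨ε₂, hε₂, CS, hCS, νc, hνc, κc, hκc, hdec⟩ := decomp_of_nl0_pair (n := n)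
  -- the k-free line of gen 104 with the Poincaré constant `8·CPLine + 1`
  obtain ⟨CP, hCP⟩ : ∃ CP : ℝ, CP = 8 * CPLine 4 2 2 (1 / 10 ^ 17) (1 / 10 ^ 53) + 1 := ⟨_, rfl⟩
  have hCP1 : 1 ≤ CP := by rw [hCP]; have := CPLine_nonneg_d4_L2; linarith
  have hCP0 : 0 < CP := by linarith
  obtain ⟨Q, hQ⟩ : ∃ Q : ℝ, Q = 2 * (1 + CP) := ⟨_, rfl⟩
  have hQ4 : 4 ≤ Q := by rw [hQ]; linarith
  have hQ0 : 0 < Q := by linarith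
  obtain ⟨cL, hcL⟩ : ∃ cL : ℝ, cL = 2 * κc + νc ^ 2 + 2304 * (CS ^ 2 * Real.exp (2 * CS)) + 112 * (1 + 7 * CS ^ 2) + 1 := ⟨_, rfl⟩
  have hcL0 : 0 < cL := by rw [hcL]; positivity
  obtain ⟨ε₃, hε₃⟩ : ∃ ε₃ : ℝ, ε₃ = (1 / 2) / Q / 4 / cL := ⟨_, rfl⟩
  have hε₃0 : 0 < ε₃ := by rw [hε₃]; positivity
  have hcard : (0 : ℝ) < 1000000000000000000000 * (Fintype.card n : ℝ) := by rw [hn]; norm_num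
  refine ⟨min ε₁ (min ε₂ (min (1 / 10 ^ 53) (min (1 / (1000000000000000000000 * (Fintype.card n : ℝ))) (min ε₃ 1)))),
    lt_min hε₁ (lt_min hε₂ (lt_min (by norm_num) (lt_min (by positivity) (lt_min hε₃0 one_pos)))), ?_⟩
  intro ε hε hεle N _ hN
  have hεε₁ : ε ≤ ε₁ := hεle.trans (min_le_left _ _)
  have hεε₂ : ε ≤ ε₂ := hεle.trans ((min_le_right _ _).trans (min_le_left _ _))
  have hε53 : ε ≤ 1 / 10 ^ 53 := hεle.trans ((min_le_right _ _).trans ((min_le_right _ _).trans (min_le_left _ _)))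
  have hεθ : ε ≤ 1 / (1000000000000000000000 * (Fintype.card n : ℝ)) :=
    hεle.trans ((min_le_right _ _).trans ((min_le_right _ _).trans ((min_le_right _ _).trans (min_le_left _ _))))
  have hεε₃ : ε ≤ ε₃ := hεle.trans ((min_le_right _ _).trans ((min_le_right _ _).trans ((min_le_right _ _).trans ((min_le_right _ _).trans (min_le_left _ _)))))
  have hε1 : ε ≤ 1 := hεle.trans ((min_le_right _ _).trans ((min_le_right _ _).trans ((min_le_right _ _).trans ((min_le_right _ _).trans (min_le_right _ _)))))
  have hε11 : ε ≤ 1 / 10 ^ 11 := hε53.trans (by norm_num)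
  have hε11' : ε / 4 ≤ 1 / 10 ^ 11 := by linarith
  have hε4 : 0 < ε / 4 := by positivity
  have hθline : 1000000000000000000000 * (Fintype.card n : ℝ) * ε ≤ 1 := by
    rw [le_div_iff₀ hcard] at hεθ; linarith
  have hsmall : cL * ε ≤ (1 / 2) / Q / 4 := by
    have h1 : cL * ε ≤ cL * ε₃ := mul_le_mul_of_nonneg_left hεε₃ hcL0.le
    have h2 : cL * ε₃ = (1 / 2) / Q / 4 := by rw [hε₃]; field_simp
    linarith only [h1, h2]
  have hline := line_of_small hQ4 hCS hε hε1 (by rw [← hcL]; exact hsmall)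
  have hls := levelSmall_all_d4_L2 hε.le hε11
  -- the 𝒯_E instances of (hT) and (hP) on the SU(2) class
  have hT : ∀ (j : ℕ) (W : Site 4 → Fin 4 → (Matrix n n ℂ)ˣ), W ∈ sfClass 4 2 N ε (j + 1) → ∀ F : Finset (T4AveragingDeficitWall.Plaq 4),
      (∀ φ : Site 4 → Fin 4 → Matrix n n ℂ, IsSkewDir φ → IsPeriodicDir φ ((AveragingDeficitMultiLevelPrep.tower 2 N (j + 1) : ℕ) : ℤ) →
        TangentIter 2 j W φ → dAction W φ F = 0) →
      ∀ Y ∈ energyBlockLandauW (d := 4) (n := n) 2 N (j + 1) W, dAction W Y F = 0 :=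
    fun j W hW F htan => hT_energyBlockLandau (by norm_num) hε.le hls j W hW F htan
  have hP : ∀ (j : ℕ) (W : Site 4 → Fin 4 → (Matrix n n ℂ)ˣ), W ∈ sfClass 4 2 N ε (j + 1) →
      SlicePoincare 2 (j + 1) W (energyBlockLandauW (d := 4) (n := n) 2 N (j + 1) W) CP (periodBox (d := 4) (N * 2 ^ (j + 1))) :=
    fun j W hW => slicePoincare_mono (classSlicePoincare_energyBlockLandau_SU2 hn hN hε hε53 j W hW) (by rw [hCP]; linarith)
  -- the data radii: the (8)∃ minimisers of the `ε`-class and of the `ε/4`-class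
  obtain ⟨δ₁, hδ₁, hint₁⟩ := H ε hε hεε₁ N hN
  obtain ⟨δ₄, hδ₄, hint₄⟩ := H (ε / 4) hε4 (by linarith) N hN
  refine ⟨min δ₁ δ₄, lt_min hδ₁ hδ₄, ?_⟩
  intro V hV k
  obtain ⟨hVu, hVP, hVδ⟩ := hV
  have hV₁ : V ∈ {V : Site 4 → Fin 4 → (Matrix n n ℂ)ˣ | IsUnitaryCfg V ∧ IsPeriodicCfg V (N : ℤ) ∧ SmallField V δ₁} :=
    ⟨hVu, hVP, MinimalActionRate.SmallField.mono hVδ (min_le_left _ _)⟩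
  have hV₄ : V ∈ {V : Site 4 → Fin 4 → (Matrix n n ℂ)ˣ | IsUnitaryCfg V ∧ IsPeriodicCfg V (N : ℤ) ∧ SmallField V δ₄} :=
    ⟨hVu, hVP, MinimalActionRate.SmallField.mono hVδ (min_le_right _ _)⟩
  cases k with
  | zero =>
      -- level 0: the datum is the only admissible configuration
      obtain ⟨U₀, hU₀, -⟩ := hint₁ V hV₁ 0
      refine ⟨U₀, hU₀, fun U' hU' => ⟨fun _ => 1, fun _ => (unitaryUnits (Matrix n n ℂ)).one_mem, fun _ _ => rfl, ?_⟩⟩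
      rw [gaugeAct_one, eq_of_admissible_zero hU'.mem, eq_of_admissible_zero hU₀.mem]
  | succ j =>
      obtain ⟨Us, hUs, a, ha0, haε, hUsa⟩ := hint₄ V hV₄ (j + 1)
      have hmem : Us ∈ admissible (sfClass 4 2 N ε) 2 (j + 1) V := admissible_mono_radius (by linarith) hUs.mem
      have hls4 := levelSmall_all_d4_L2 hε4.le hε11' j
      have hcrit := tanCritical_of_isMinimiser (le_refl 1 |>.trans one_le_two) hN hUs ha0 haε hUsa hls4
      have hM1 : (1 : ℝ) ≤ ((2 : ℕ) : ℝ) ^ (j + 1) := one_le_pow₀ (by norm_num)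
      -- every competitor with no larger action is a gauge copy of `U♯`
      have horbit : ∀ U' ∈ admissible (sfClass 4 2 N ε) 2 (j + 1) V, levelAction 4 2 N (j + 1) U' ≤ levelAction 4 2 N (j + 1) Us →
          ∃ u : Site 4 → (Matrix n n ℂ)ˣ, IsUnitarySite u ∧ IsPeriodicSite u ((N * 2 ^ (j + 1) : ℕ) : ℤ) ∧ gaugeAct u U' = Us := by
        intro U' hU' hmin'
        obtain ⟨u, X, XT, XN, α, ν, κ, hu, huP, hXs, hXP, hα, hXα, hgauge, hXdec, hXT, -, hXN, hν, hNw, hN1, hαM, hνle, hκle⟩ :=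
          hdec N ε hε hεε₂ hθline V j Us hmem U' hU'
        -- the per-level strict line from the k-free one
        have hck := kfree_coercivity (ε := ε) hCP0.le hM1 hν hνle hα hαM
        have hlinek : 2 * κ < ((((1 / 2 - ν ^ 2) / (2 * (1 + CP)) - ν ^ 2) / 2
            - 576 * ((4 : ℕ) : ℝ) * (Real.exp α - 1) ^ 2 * (((2 : ℕ) : ℝ) ^ (j + 1)) ^ 2) / (Fintype.card n : ℝ)
            - 28 * ((4 : ℕ) : ℝ) * (ε / (((2 : ℕ) : ℝ) ^ (j + 1)) ^ 2 + 7 * α ^ 2) * (((2 : ℕ) : ℝ) ^ (j + 1)) ^ 2) := by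
          rw [hQ] at hline
          rw [hn]
          have h2κ : 2 * κ ≤ 2 * (κc * ε) := by linarith
          push_cast at hck hline ⊢
          linarith
        -- the gauge identity gives the action comparison and the class radius of the representative
        have hle : levelAction 4 2 N (j + 1) (vary Us X 1) ≤ levelAction 4 2 N (j + 1) U' := by
          rw [← hgauge, levelAction_gaugeAct]
        have h1 : SmallField (vary Us X 1) (ε / (((2 : ℕ) : ℝ) ^ (j + 1)) ^ 2) := by
          rw [← hgauge]; exact smallField_gaugeAct hu hU'.1.2.2
        obtain ⟨-, hself⟩ := vary_eq_self_of_tanCritical_rep_generic (d := 4) (le_refl 1 |>.trans one_le_two) hN hε.le hCP0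
          (fun j W => energyBlockLandauW (d := 4) (n := n) 2 N (j + 1) W) hT hP hmem hcrit hmin' hXs hXP hα hXα hle h1 hXdec hXT hXN hNw hN1 hlinek
        refine ⟨u, hu, huP, ?_⟩
        rw [hgauge, hself]
      -- `U♯` is itself a minimiser of the `ε`-class: the (8)∃ minimiser of the `ε`-class is a gauge copy of it
      obtain ⟨U₁, hU₁, -⟩ := hint₁ V hV₁ (j + 1)
      obtain ⟨u₁, -, -, hg₁⟩ := horbit U₁ hU₁.mem (hU₁.le Us hmem)
      have hUsmin : IsMinimiser 4 (sfClass 4 2 N ε) 2 N (j + 1) V Us := by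
        refine ⟨hmem, fun U' hU' => ?_⟩
        rw [← hg₁, levelAction_gaugeAct]
        exact hU₁.le U' hU'
      exact ⟨Us, hUsmin, fun U' hU' => horbit U' hU'.mem (hU'.le Us hmem)⟩

end

end Summit.QuantumFields.BalabanUV.T4Continuum.NE7MinimalOrbitUniqueSU2
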